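import Summits.NavierStokesRegularity.NavierStokesRegularity.Theorems.EfficiencyFloorMaximiserSetRigidityProfileLiouvilleDrift
import Summits.NavierStokesRegularity.NavierStokesRegularity.Theses.EfficiencyFloor
import HarnessLib

/-!
# Route `EfficiencyFloor`, crux `MaximiserSetRigidity` (stmt-NavierStokesRegularity-25512) BY NAME:
# the route decl follows from part (a) and the ROTATING collapse Liouville theorem alone

Helper file (`--supports stmt-NavierStokesRegularity-25512 --as helper`). Pure logic over the landed chain
p820129 → p820369 → p820514 → p820919 → p821293 ((EB) proved) → p821335 / p821401 (non-rotating relative equilibria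
excluded unconditionally, Tsai 1998) → p821439 (`partB_of_rotatingCollapseLiouville`). It records the EXACT residual
of the item in the kernel, against the route decl `Summit.….Theses.EfficiencyFloor.MaximiserSetRigidity` VERBATIM:

* `maximiserSetRigidity_of_partA_of_rotatingCollapseLiouville` —
  `PartA → RotatingCollapseLiouville → MaximiserSetRigidity`, where
  - `PartA` is the item's clause (a) verbatim (for the sharp constant `c` and `ν > 0`: finitely many normalised
    maximisers `ms : Fin k → _` classifying every normalised maximiser up to translation, linear isometry and
    scaling) — the BET, untouched;
  - `RotatingCollapseLiouville` (L⁺_rot) — for every `ν > 0`: no admissible `m` (`D⁰m, D¹m, D²m ∈ L²`) with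
    `Z(m) > 0` solves the relative-equilibrium profile equation with a NON-ZERO skew-adjoint `W` and a collapsing
    rate `c′ > 0` (rotating backward self-similar profile of finite energy; known mathematics via
    Escauriaza–Seregin–Šverák 2003 applied to the orbit `t ↦ g(t)·m` — constant `L³` norm —, NOT typed: the
    tree's `L³` continuation criterion `hasSmoothExtensionPast_of_eLpNorm_three_bounded` asks for a rapidly decaying
    datum, which a profile `m ∈ H²` does not supply).
  Both hypotheses are spelled out in the item's vocabulary (no new definitions).

So the (b)-half of stmt-25512 is reduced to (L⁺_rot) and nothing else; every other relative equilibrium (steady,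
travelling, expanding, non-rotating collapsing, any drift) is excluded by the landed theorems. HONEST FRAMING: an
implication with two OPEN hypotheses; stmt-25512, `RigidExit`, `NearMaximiserBoundedAmplification`, `LerayFloorGap`,
`ProductionEfficiencyDecay` and Navier–Stokes regularity stay OPEN; no summit statement is proved. [folklore]
-/

noncomputable section

-- the problem directory repeats the summit name (`NavierStokesRegularity/NavierStokesRegularity`)
set_option linter.dupNamespace false

namespace Summit.NavierStokesRegularity.NavierStokesRegularity.Theorems

namespace MaximiserSetRigidity

open MeasureTheory
open scoped InnerProductSpace

/-- **`MaximiserSetRigidity` ⟸ part (a) ∧ (L⁺_rot).** The first hypothesis is the item's clause (a) verbatim (existence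
of finitely many normalised maximisers classifying all of them modulo the symmetry group); the second is the rotating
collapse Liouville theorem (L⁺_rot) in the item's vocabulary; the conclusion is the route decl by name. Part (b) for
each normalised maximiser is `ProfileLiouville.partB_of_rotatingCollapseLiouville` (non-rotating equilibria: Tsai 1998
+ the proved enstrophy balance; rotating: (L⁺_rot)). [folklore] -/
theorem maximiserSetRigidity_of_partA_of_rotatingCollapseLiouville
    (hA : ∀ c ν : ℝ, (0 < c ∧ (∀ v : EuclideanSpace ℝ (Fin 3) → EuclideanSpace ℝ (Fin 3), (ContDiff ℝ (⊤ : ℕ∞) v ∧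
      Literature.Analysis.FluidPDE.VectorCalculus.IsDivFree v ∧ (∫⁻ x, ‖iteratedFDeriv ℝ 0 v x‖ₑ ^ 2 < ⊤) ∧
      (∫⁻ x, ‖iteratedFDeriv ℝ 1 v x‖ₑ ^ 2 < ⊤) ∧ (∫⁻ x, ‖iteratedFDeriv ℝ 2 v x‖ₑ ^ 2 < ⊤)) → (∫ x,
      ⟪Literature.Analysis.FluidPDE.curl v x, fderiv ℝ v x (Literature.Analysis.FluidPDE.curl v x)⟫_ℝ) ≤ c *
      (∫ x, ‖Literature.Analysis.FluidPDE.curl v x‖ ^ 2) ^ (3 / 4 : ℝ) * (∫ x,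
      Literature.Analysis.FluidPDE.frobeniusNormSq (fderiv ℝ (Literature.Analysis.FluidPDE.curl v) x)) ^ (3 / 4
      : ℝ)) ∧ ∀ c' : ℝ, (∀ w : EuclideanSpace ℝ (Fin 3) → EuclideanSpace ℝ (Fin 3), (ContDiff ℝ (⊤ : ℕ∞) w ∧
      Literature.Analysis.FluidPDE.VectorCalculus.IsDivFree w ∧ (∫⁻ x, ‖iteratedFDeriv ℝ 0 w x‖ₑ ^ 2 < ⊤) ∧
      (∫⁻ x, ‖iteratedFDeriv ℝ 1 w x‖ₑ ^ 2 < ⊤) ∧ (∫⁻ x, ‖iteratedFDeriv ℝ 2 w x‖ₑ ^ 2 < ⊤)) → (∫ x,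
      ⟪Literature.Analysis.FluidPDE.curl w x, fderiv ℝ w x (Literature.Analysis.FluidPDE.curl w x)⟫_ℝ) ≤ c' *
      (∫ x, ‖Literature.Analysis.FluidPDE.curl w x‖ ^ 2) ^ (3 / 4 : ℝ) * (∫ x,
      Literature.Analysis.FluidPDE.frobeniusNormSq (fderiv ℝ (Literature.Analysis.FluidPDE.curl w) x)) ^ (3 / 4
      : ℝ)) → c ≤ c') → 0 < ν → ∃ (k : ℕ) (ms : Fin k → EuclideanSpace ℝ (Fin 3) → EuclideanSpace ℝ (Fin 3)), (∀
      i, ((ContDiff ℝ (⊤ : ℕ∞) (ms i) ∧ Literature.Analysis.FluidPDE.VectorCalculus.IsDivFree (ms i) ∧ (∫⁻ x,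
      ‖iteratedFDeriv ℝ 0 (ms i) x‖ₑ ^ 2 < ⊤) ∧ (∫⁻ x, ‖iteratedFDeriv ℝ 1 (ms i) x‖ₑ ^ 2 < ⊤) ∧ (∫⁻ x,
      ‖iteratedFDeriv ℝ 2 (ms i) x‖ₑ ^ 2 < ⊤)) ∧ 0 < (∫ x, ‖Literature.Analysis.FluidPDE.curl (ms i) x‖ ^ 2) ∧
      (∫ x, ⟪Literature.Analysis.FluidPDE.curl (ms i) x, fderiv ℝ (ms i) x (Literature.Analysis.FluidPDE.curl
      (ms i) x)⟫_ℝ) = c * (∫ x, ‖Literature.Analysis.FluidPDE.curl (ms i) x‖ ^ 2) ^ (3 / 4 : ℝ) * (∫ x,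
      Literature.Analysis.FluidPDE.frobeniusNormSq (fderiv ℝ (Literature.Analysis.FluidPDE.curl (ms i)) x)) ^ (3
      / 4 : ℝ) ∧ (∫ x, Literature.Analysis.FluidPDE.frobeniusNormSq (fderiv ℝ (Literature.Analysis.FluidPDE.curl
      (ms i)) x)) = 81 * c ^ 4 / (256 * ν ^ 4) * (∫ x, ‖Literature.Analysis.FluidPDE.curl (ms i) x‖ ^ 2) ^ 3)) ∧
      ∀ m : EuclideanSpace ℝ (Fin 3) → EuclideanSpace ℝ (Fin 3), ((ContDiff ℝ (⊤ : ℕ∞) m ∧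
      Literature.Analysis.FluidPDE.VectorCalculus.IsDivFree m ∧ (∫⁻ x, ‖iteratedFDeriv ℝ 0 m x‖ₑ ^ 2 < ⊤) ∧
      (∫⁻ x, ‖iteratedFDeriv ℝ 1 m x‖ₑ ^ 2 < ⊤) ∧ (∫⁻ x, ‖iteratedFDeriv ℝ 2 m x‖ₑ ^ 2 < ⊤)) ∧ 0 < (∫ x,
      ‖Literature.Analysis.FluidPDE.curl m x‖ ^ 2) ∧ (∫ x, ⟪Literature.Analysis.FluidPDE.curl m x, fderiv ℝ m x
      (Literature.Analysis.FluidPDE.curl m x)⟫_ℝ) = c * (∫ x, ‖Literature.Analysis.FluidPDE.curl m x‖ ^ 2) ^ (3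
      / 4 : ℝ) * (∫ x, Literature.Analysis.FluidPDE.frobeniusNormSq (fderiv ℝ (Literature.Analysis.FluidPDE.curl
      m) x)) ^ (3 / 4 : ℝ) ∧ (∫ x, Literature.Analysis.FluidPDE.frobeniusNormSq (fderiv ℝ
      (Literature.Analysis.FluidPDE.curl m) x)) = 81 * c ^ 4 / (256 * ν ^ 4) * (∫ x,
      ‖Literature.Analysis.FluidPDE.curl m x‖ ^ 2) ^ 3) → (∃ (i : Fin k) (a : EuclideanSpace ℝ (Fin 3)) (R :
      EuclideanSpace ℝ (Fin 3) ≃ₗᵢ[ℝ] EuclideanSpace ℝ (Fin 3)) (l : ℝ), 0 < l ∧ m = fun x => l • R (ms i (l •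
      R.symm (x - a)))))
    (hL : ∀ (ν : ℝ), 0 < ν → ∀ (m : EuclideanSpace ℝ (Fin 3) → EuclideanSpace ℝ (Fin 3)) (π : EuclideanSpace ℝ (Fin
      3) → ℝ) (a : EuclideanSpace ℝ (Fin 3)) (W : EuclideanSpace ℝ (Fin 3) →L[ℝ] EuclideanSpace ℝ (Fin 3)) (c' :
      ℝ), (ContDiff ℝ (⊤ : ℕ∞) m ∧ Literature.Analysis.FluidPDE.VectorCalculus.IsDivFree m ∧ (∫⁻ x,
      ‖iteratedFDeriv ℝ 0 m x‖ₑ ^ 2 < ⊤) ∧ (∫⁻ x, ‖iteratedFDeriv ℝ 1 m x‖ₑ ^ 2 < ⊤) ∧ (∫⁻ x, ‖iteratedFDeriv ℝ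
      2 m x‖ₑ ^ 2 < ⊤)) → 0 < (∫ x, ‖Literature.Analysis.FluidPDE.curl m x‖ ^ 2) → ContDiff ℝ (⊤ : ℕ∞) π → (∀ x
      y : EuclideanSpace ℝ (Fin 3), ⟪W x, y⟫_ℝ = -⟪x, W y⟫_ℝ) → W ≠ 0 → 0 < c' → ¬ (∀ x : EuclideanSpace ℝ (Fin
      3), ν • Laplacian.laplacian m x - Literature.Analysis.FluidPDE.convect m m x - gradient π x = fderiv ℝ m x
      a + (fderiv ℝ m x (W x) - W (m x)) + c' • (m x + fderiv ℝ m x x)))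
    : Summit.NavierStokesRegularity.NavierStokesRegularity.Theses.EfficiencyFloor.MaximiserSetRigidity := by
  intro c ν hc hν
  obtain ⟨k, ms, hms, hclass⟩ := hA c ν hc hν
  refine ⟨k, ms, hms, fun m hm => ⟨hclass m hm, ?_⟩⟩
  exact ProfileLiouville.partB_of_rotatingCollapseLiouville c ν hc.1 hν (hL ν hν) m hm

/-- **Rotations about a symmetry axis of the maximiser are harmless.** If the normalised maximiser `m` is
`W`-EQUIVARIANT — `Dm(x)(Wx) = W m(x)` for all `x`, i.e. `m` is invariant under the rotations `e^{θW}` (e.g. an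
axisymmetric colliding-vortex-ring maximiser and `W` the generator of rotations about its axis, the configuration
expected from Lu–Doering 2008 / Ayala–Protas 2017) — then the rotation term of the relative-equilibrium equation
vanishes identically and the item's (b)-clause for this `W` (all smooth `π`, drifts `a`, rates `c′`) holds
UNCONDITIONALLY by `ProfileLiouville.partB_noRotation`. So (L⁺_rot) is only needed for rotations that actually
move the maximiser. [folklore] -/
theorem partB_of_equivariant (c ν : ℝ) (hc : 0 < c) (hν : 0 < ν)
    (m : EuclideanSpace ℝ (Fin 3) → EuclideanSpace ℝ (Fin 3))
    (hm : ((ContDiff ℝ (⊤ : ℕ∞) m ∧ Literature.Analysis.FluidPDE.VectorCalculus.IsDivFree m ∧ (∫⁻ x, ‖iteratedFDeriv ℝ 0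
      m x‖ₑ ^ 2 < ⊤) ∧ (∫⁻ x, ‖iteratedFDeriv ℝ 1 m x‖ₑ ^ 2 < ⊤) ∧ (∫⁻ x, ‖iteratedFDeriv ℝ 2 m x‖ₑ ^ 2 < ⊤))
      ∧ 0 < (∫ x, ‖Literature.Analysis.FluidPDE.curl m x‖ ^ 2) ∧ (∫ x, ⟪Literature.Analysis.FluidPDE.curl m x,
      fderiv ℝ m x (Literature.Analysis.FluidPDE.curl m x)⟫_ℝ) = c * (∫ x, ‖Literature.Analysis.FluidPDE.curl
      m x‖ ^ 2) ^ (3 / 4 : ℝ) * (∫ x, Literature.Analysis.FluidPDE.frobeniusNormSq (fderiv ℝ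
      (Literature.Analysis.FluidPDE.curl m) x)) ^ (3 / 4 : ℝ) ∧ (∫ x,
      Literature.Analysis.FluidPDE.frobeniusNormSq (fderiv ℝ (Literature.Analysis.FluidPDE.curl m) x)) = 81 *
      c ^ 4 / (256 * ν ^ 4) * (∫ x, ‖Literature.Analysis.FluidPDE.curl m x‖ ^ 2) ^ 3))
    (W : EuclideanSpace ℝ (Fin 3) →L[ℝ] EuclideanSpace ℝ (Fin 3))
    (hequiv : ∀ x : EuclideanSpace ℝ (Fin 3), fderiv ℝ m x (W x) = W (m x)) :
    ∀ (π : EuclideanSpace ℝ (Fin 3) → ℝ) (a : EuclideanSpace ℝ (Fin 3)) (c' : ℝ), ContDiff ℝ (⊤ : ℕ∞) π →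
      ¬ (∀ x : EuclideanSpace ℝ (Fin 3), ν • Laplacian.laplacian m x - Literature.Analysis.FluidPDE.convect m m x -
        gradient π x = fderiv ℝ m x a + (fderiv ℝ m x (W x) - W (m x)) + c' • (m x + fderiv ℝ m x x)) := by
  intro π a c' hπ heq
  refine ProfileLiouville.partB_noRotation c ν hc hν m hm π a c' hπ (fun x => ?_)
  rw [heq x, hequiv x, sub_self]
  simp only [zero_apply, map_zero, sub_self]

end MaximiserSetRigidity

end Summit.NavierStokesRegularity.NavierStokesRegularity.Theorems

end
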